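import Summits.CriticalPhenomena.PercolationContinuityZ3.Theorems.FK.Transplant.KNFreeSeedsEnergy
import HarnessLib

/-!
# FRONTIER TRANSPLANT, row FT-03(a), part 2: Kozma–Nitzan's Lemma 10 under an ARBITRARY finite-energy law — STEP II (a level with many
# contact vertices, eqs. (17)–(18)) and the seed-manufacture bound `μ(𝒢) > 1 - 3δ` (eqs. (19)–(20))

Support file (`--supports stmt-CriticalPhenomena-4575`, helper) of the FRONTIER TRANSPLANT sub-cell (`fk-continuity/transplant/`,
registry row FT-03, seat `prim-bschramm-fkt-p1`); builds on p205010 (kernel theorem, internal audit signed; external expert review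
pending).  No definitions, no named facts, no sorries; standard axioms.

HONEST FRAMING (page 1, cell rule).  The transplant's theorem of record `ufsc0_of_freeBoundaryHypothesis_r0 : FH 3 q p → … → ∃ r, UFSC0 3 q p r ε₀`
is CONDITIONAL on the free-boundary penetration hypothesis FH — open at the same `p` for every `q > 1`; by the referee's calibration K1,
[C3a for all `p > p_c(q)`] ∧ C3b gives `p̂_c(q) = p_c(q)`, Grimmett's Conjecture (5.103) / Duminil-Copin–Tassion's Question 5
(arXiv:1707.07626, p. 9), open for `q ∈ (1,2)`; see the barrier note `SamePFreeBoundaryCriteria` (cell row FBN-01,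
`Literature/Barriers/CriticalPhenomena/`, cited statements only) and `FO-19-RECOMMENDATION.md` (NO-GO on criterion 1).  The transplant is a
typed reduction, not a proof of FK continuity.  THIS FILE is unconditional: it is a piece of KN Lemma 10 with the measure as a PARAMETER.

WHAT IS PORTED HERE.  Kozma–Nitzan, arXiv:2401.12397, Lemma 10, Step II (p. 18: some level `j` of the enlargements `B⟨j⟩` at which the
cluster of `o` outside `B⟨j⟩` has at least `N` contact vertices with probability `> 1 - 2δ`; the variable `X`, eqs. (17)–(18)), proved for
Bernoulli percolation in the tree as `KozmaNitzan.LHyp.real_Hev_inter_Djo_le` / `….real_Aev_le` / `….stepII`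
(`Literature/Probability/Percolation/KozmaNitzanTargetLemma.lean`, where (18) is `prodBernoulli_real_inter_of_determinedBy` + the exact
closing probability `prodBernoulli_real_forall_notMem`), and the combination with Step III of part 1 (`KNFreeSeedsEnergy.lean`).

THE HYPOTHESES ON THE LAW.  `μ` is an arbitrary probability measure on the bond configurations of `ℤ^d`; the weighting `W` (a lattice
subbox, `KozmaNitzan.IsSubbox`, inside `KozmaNitzan.LHyp`) only says which pairs are edges of weight `p`.  The product-measure sites of the
printed proof (refuter catalogue `REFUTER-REPORT.md` §5 "Lemma 10 Step II / Step III"; memo A §3.2 (M5)) are replaced by the two-sided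
FINITE-ENERGY inequalities in integrated form, taken as hypotheses (Grimmett 2006, Thm. (3.1) eq. (3.4), Thm. (4.17)(b); for the random-cluster
measures with `q ≥ 1` they are the cell's tree theorems `FK.rcMeasure_pow_mul_real_preimage_sdiff_le` /
`FK.rcMeasure_pow_mul_real_preimage_openEdges_le`, `T/FK/RandomClusterFiniteEnergy.lean`, valid under every boundary condition and hence
under every conditioned law of the transplant; at `q = 1` insertion tolerance is the tree's `bondPercolation_pow_mul_real_preimage_openEdges_le`):
* deletion tolerance `hdel`: `(1 - p)^{|F|} · μ{ω | ω ∖ F ∈ A} ≤ μ(A)` for finite sets `F` of pairs of weight `p` and measurable `A`;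
* insertion tolerance `hins`: `π^{|F|} · μ{ω | ω ∪ F ∈ A} ≤ μ(A)` (`0 ≤ π ≤ 1`; `π = p/(p + q(1-p))` for `φ_{p,q}`, `π = p` at `q = 1`);
* `hnull`: pairs of weight `0` are almost surely closed (`μ((PosOnly W)ᶜ) = 0`).
The GEOMETRY (levels `B⟨j⟩`, contact sets `Kont`, failure levels `H_{t,j}` / `A_t`, seeds `seedE` behind far-apart contacts, `LData` /
`LHyp`) is the tree's `KozmaNitzanTargetLemma` / `KozmaNitzanBoxes`, IMPORTED AS IS (coordinator R7(f)); the binder `KNFreeSeedBound` of the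
record (FT-02, fkt-lead) is to be discharged from these files once its law is typed (G-T1) — nothing here depends on that typing.

RESULTS (namespace `…Theorems.FK.KNFree`; `hL : KozmaNitzan.LHyp L W p D R`):
* `real_Hev_inter_Djo_le` — eq. (18) under deletion tolerance: `μ(H_{t,j} ∩ D_j) ≤ (1 - (1-p)^{2dN}) μ(H_{t,j})`;
* `real_Aev_le` — eqs. (17)–(18): `μ(A_t) ≤ (1 - (1-p)^{2dN})^t`;
* `sum_real_inter_Fail_eq` — the counting identity behind `X`, for any finite measure;
* **`stepII`** — some level `j ∈ [j₀, j₁]` has `≥ N` contact vertices with probability `> 1 - 2δ`;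
* **`exists_level_real_Gev_gt`** — Steps II + III: at that level, with probability `> 1 - 3δ` some selected contact vertex carries an OPEN
  SEED (KN's event `𝒢`, eq. (19); the seeds are the wired relays of the transplant's route D, memo A §3.2 / refuter F2).
[cite: KozmaNitzan2024, §4 Lemma 10, Step II, eqs. (17)–(20) (pp. 18–19)] [cite: Grimmett2006, Thm. (3.1) eq. (3.4) (p. 38); Thm. (4.17)(b) (p. 75)]
-/

noncomputable section

namespace Summit.CriticalPhenomena.PercolationContinuityZ3.Theorems.FK.KNFree

open MeasureTheory Set SimpleGraph
open Literature.Probability.Percolation Literature.Probability.LatticeModels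
open Literature.Probability.Percolation.KozmaNitzan
open scoped Classical

variable {d : ℕ}

variable {W : Sym2 (Site d) → unitInterval} {p : unitInterval} (μ : Measure (BondConfig (Site d))) [IsProbabilityMeasure μ]

/-! ## Step II under `μ` (KN p. 18): a level with many contact vertices -/

section StepII

variable {L : LData d} {D : Finset (Site d)} {R : ℕ} (hL : LHyp L W p D R)
include hL

/-- **The one-level estimate (18) under deletion tolerance**: `μ(H_{t,j} ∩ D_j) ≤ (1 - (1-p)^{2dN}) · μ(H_{t,j})` — condition on the
contact set `κ` (fewer than `N` vertices on `H_{t,j} ⊆ Fail_j`); `H_{t,j} ∩ {Kont = κ}` is determined by the pairs outside `B⟨j⟩`, the at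
most `2dN` contact edges of `κ` are pairs of weight `p` inside `B⟨j⟩`, and an open one costs `1 - (1-p)^{2dN}` by
`real_inter_exists_mem_le_of_del` (KN: "each such vertex has exactly one edge connecting it to `B⟨j_i⟩` and hence the probability that
they are all closed is at least `(1-p)^{k(4M)^{d-1}}`" — for `φ_{p,q}`, `q ≥ 1`, the same bound is finite energy).
[cite: KozmaNitzan2024, §4 p. 18 eq. (18)] [cite: Grimmett2006, Thm. (3.1) eq. (3.4) (p. 38)] -/
theorem real_Hev_inter_Djo_le
    (hdel : ∀ (F : Finset (Sym2 (Site d))) (A : Set (BondConfig (Site d))), (∀ e ∈ F, W e = p) → MeasurableSet A →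
      (1 - (p : ℝ)) ^ F.card * μ.real ((fun ω => ω \ ↑F) ⁻¹' A) ≤ μ.real A)
    {N : ℕ} {J : Finset ℕ} (hJ : ∀ j' ∈ J, j' ≤ R) {t j : ℕ} (hj : j ∈ J) :
    μ.real (L.Hev N J t j ∩ L.Djo j) ≤ (1 - (1 - (p : ℝ)) ^ (2 * d * N)) * μ.real (L.Hev N J t j) := by
  classical
  set r : ℝ := 1 - (1 - (p : ℝ)) ^ (2 * d * N) with hr
  have hXS : ∀ j' ∈ J, L.X j' ⊆ L.Sfin := fun j' hj' => hL.X_subset_Sfin (by have := hJ j' hj'; omega)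
  have hjR : j ≤ R := hJ j hj
  set OB := outerBoundary (zdGraph d) (L.X j) with hOB
  set B : Finset (Site d) → Set (BondConfig (Site d)) := fun κ => L.Hev N J t j ∩ {ω | L.Kont j ω = κ} with hB
  set Op : Finset (Site d) → Set (BondConfig (Site d)) := fun κ => {ω | ∃ e ∈ L.cEdges j κ, e ∈ ω} with hOp
  have hBdet : ∀ κ, DeterminedBy (B κ) (wireSet (L.region j)) := by
    intro κ
    rw [determinedBy_iff]
    intro ω ω' hω
    have h1 : ∀ e ∈ wireSet (L.region j), e ∈ ω ↔ e ∈ ω' := fun e he => by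
      have := Set.ext_iff.1 hω e
      simp only [Set.mem_inter_iff] at this
      exact ⟨fun h' => (this.1 ⟨h', he⟩).1, fun h' => (this.2 ⟨h', he⟩).1⟩
    simp only [hB, Set.mem_inter_iff, Set.mem_setOf_eq]
    rw [LData.Hev_congr hXS h1, LData.Kont_congr h1]
  have hBm : ∀ κ, MeasurableSet (B κ) := fun κ =>
    ((hBdet κ).mono (L.wireSet_region_subset j)).measurableSet_of_finset
  have hOpm : ∀ κ, MeasurableSet (Op κ) := fun κ => measurableSet_exists_mem (L.cEdges j κ)
  -- the one-piece estimate `μ(Op κ ∩ B κ) ≤ r · μ(B κ)` for `κ ⊆ ∂B⟨j⟩`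
  have hpiece : ∀ κ, κ ⊆ OB → μ.real (Op κ ∩ B κ) ≤ r * μ.real (B κ) := by
    intro κ hκ
    by_cases hcard : κ.card < N
    · have h1 := real_inter_exists_mem_le_of_del μ hdel (hBdet κ)
        (fun e he => LData.cEdges_disjoint_wireSet_region he) (hBm κ) (fun e he => hL.W_cEdge hjR hκ he)
      rw [Set.inter_comm]
      refine h1.trans (mul_le_mul_of_nonneg_right ?_ measureReal_nonneg)
      have hp0 : (0 : ℝ) ≤ 1 - p := sub_nonneg.2 p.2.2
      have hp1' : 1 - (p : ℝ) ≤ 1 := sub_le_self _ p.2.1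
      have hle : (L.cEdges j κ).card ≤ 2 * d * N :=
        (L.card_cEdges_le j κ).trans (Nat.mul_le_mul_left _ hcard.le)
      have := pow_le_pow_of_le_one hp0 hp1' hle
      rw [hr]; linarith
    · -- `B κ = ∅` since `H ⊆ Fail`
      have hBempty : B κ = ∅ := by
        ext ω
        simp only [hB, Set.mem_inter_iff, Set.mem_setOf_eq, Set.mem_empty_iff_false, iff_false, not_and]
        rintro ⟨hF, -, -⟩ hK
        rw [LData.Fail, Set.mem_setOf_eq, hK] at hF
        exact hcard hF
      rw [hBempty, Set.inter_empty, measureReal_empty, mul_zero]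
  -- decompositions over `κ`
  have hdecH : L.Hev N J t j = ⋃ κ ∈ OB.powerset, B κ := by
    ext ω
    simp only [Set.mem_iUnion, exists_prop, Finset.mem_powerset, hB, Set.mem_inter_iff, Set.mem_setOf_eq]
    constructor
    · intro hω; exact ⟨L.Kont j ω, Finset.filter_subset _ _, hω, rfl⟩
    · rintro ⟨κ, -, hω, -⟩; exact hω
  have hdecHD : L.Hev N J t j ∩ L.Djo j = ⋃ κ ∈ OB.powerset, (Op κ ∩ B κ) := by
    ext ω
    simp only [Set.mem_iUnion, exists_prop, Finset.mem_powerset, hB, hOp, Set.mem_inter_iff,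
      Set.mem_setOf_eq, LData.Djo]
    constructor
    · rintro ⟨hω, hD⟩; exact ⟨L.Kont j ω, Finset.filter_subset _ _, hD, hω, rfl⟩
    · rintro ⟨κ, -, hD, hω, rfl⟩; exact ⟨hω, hD⟩
  have hdisjB : (↑OB.powerset : Set (Finset (Site d))).PairwiseDisjoint B := by
    intro κ _ κ' _ hne
    rw [Function.onFun, Set.disjoint_left]
    rintro ω ⟨-, h1⟩ ⟨-, h2⟩
    exact hne (h1.symm.trans h2)
  have hdisjOB : (↑OB.powerset : Set (Finset (Site d))).PairwiseDisjoint fun κ => Op κ ∩ B κ := by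
    intro κ hκ κ' hκ' hne
    exact (hdisjB hκ hκ' hne).mono Set.inter_subset_right Set.inter_subset_right
  rw [hdecHD, measureReal_biUnion_finset hdisjOB (fun κ _ => (hOpm κ).inter (hBm κ)),
    hdecH, measureReal_biUnion_finset hdisjB (fun κ _ => hBm κ), Finset.mul_sum]
  refine Finset.sum_le_sum fun κ hκ => ?_
  rw [Finset.mem_powerset] at hκ
  exact hpiece κ hκ

/-- **`μ(A_t) ≤ (1 - (1-p)^{2dN})^t`** under deletion tolerance (KN (17)–(18): "`P(G_1 ∩ ⋯ ∩ G_{k₂}) ≤ (1 - (1-p)^{…})^{k₂}`"; the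
`t` outermost failure levels each carry an open contact edge, and (18) is applied level by level from the outside in).
[cite: KozmaNitzan2024, §4 p. 18 eqs. (17)–(18)] -/
theorem real_Aev_le
    (hdel : ∀ (F : Finset (Sym2 (Site d))) (A : Set (BondConfig (Site d))), (∀ e ∈ F, W e = p) → MeasurableSet A →
      (1 - (p : ℝ)) ^ F.card * μ.real ((fun ω => ω \ ↑F) ⁻¹' A) ≤ μ.real A)
    {N : ℕ} {J : Finset ℕ} (hJ : ∀ j' ∈ J, j' ≤ R) (t : ℕ) :
    μ.real (L.Aev N J t) ≤ (1 - (1 - (p : ℝ)) ^ (2 * d * N)) ^ t := by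
  classical
  set r : ℝ := 1 - (1 - (p : ℝ)) ^ (2 * d * N) with hr
  have hr0 : 0 ≤ r := by
    rw [hr, sub_nonneg]
    exact pow_le_one₀ (sub_nonneg.2 p.2.2) (sub_le_self _ p.2.1)
  have hXS : ∀ j' ∈ J, L.X j' ⊆ L.Sfin := fun j' hj' => hL.X_subset_Sfin (by have := hJ j' hj'; omega)
  have hHm : ∀ t j, MeasurableSet (L.Hev N J t j) := by
    intro t j
    refine (DeterminedBy.mono (F := wireSet (L.region j)) ?_ (L.wireSet_region_subset j)).measurableSet_of_finset
    rw [determinedBy_iff]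
    intro ω ω' hω
    refine LData.Hev_congr hXS fun e he => ?_
    have := Set.ext_iff.1 hω e
    simp only [Set.mem_inter_iff] at this
    exact ⟨fun h' => (this.1 ⟨h', he⟩).1, fun h' => (this.2 ⟨h', he⟩).1⟩
  induction t with
  | zero => rw [pow_zero]; exact measureReal_le_one
  | succ t ih =>
    calc μ.real (L.Aev N J (t + 1)) ≤ ∑ j ∈ J, μ.real (L.Hev N J t j ∩ L.Djo j) := by
          simp only [LData.Aev]; exact measureReal_biUnion_finset_le (μ := μ) J _
      _ ≤ ∑ j ∈ J, r * μ.real (L.Hev N J t j) :=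
          Finset.sum_le_sum fun j hj => real_Hev_inter_Djo_le μ hL hdel hJ hj
      _ = r * μ.real (⋃ j ∈ J, L.Hev N J t j) := by
          rw [← Finset.mul_sum, measureReal_biUnion_finset (fun j hj j' hj' hne =>
            LData.Hev_disjoint t hne (Finset.mem_coe.1 hj') (Finset.mem_coe.1 hj)) (fun j _ => hHm t j)]
      _ ≤ r * μ.real (L.Aev N J t) := by
          refine mul_le_mul_of_nonneg_left (measureReal_mono ?_) hr0
          exact Set.iUnion₂_subset fun j _ => LData.Hev_subset_Aev t j
      _ ≤ r * r ^ t := mul_le_mul_of_nonneg_left ih hr0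
      _ = r ^ (t + 1) := by ring

omit hL in
/-- **Counting the failure levels on an event, under any finite measure**:
`Σ_{j ∈ J} μ(C ∩ Fail_j) = Σ_{t=1}^{|J|} μ(C ∩ {t ≤ #failure levels})` (both are `E_μ[#failures; C]`; KN p. 18, the variable `X`).
[cite: KozmaNitzan2024, §4 p. 18 (the variable X)] -/
theorem sum_real_inter_Fail_eq (N : ℕ) (J : Finset ℕ) {C : Set (BondConfig (Site d))} (hC : MeasurableSet C) :
    ∑ j ∈ J, μ.real (C ∩ L.Fail N j) =
      ∑ t ∈ Finset.Icc 1 J.card, μ.real (C ∩ {ω | t ≤ (J.filter fun j => ω ∈ L.Fail N j).card}) := by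
  have hcount : ∀ t, MeasurableSet {ω : BondConfig (Site d) | t ≤ (J.filter fun j => ω ∈ L.Fail N j).card} := by
    intro t
    have : {ω : BondConfig (Site d) | t ≤ (J.filter fun j => ω ∈ L.Fail N j).card} =
        ⋃ K ∈ J.powerset.filter (fun K => t ≤ K.card), ⋂ j ∈ J, {ω | ω ∈ L.Fail N j ↔ j ∈ K} := by
      ext ω
      simp only [Set.mem_setOf_eq, Set.mem_iUnion, Set.mem_iInter, Finset.mem_filter, Finset.mem_powerset,
        exists_prop]
      constructor
      · intro h
        refine ⟨J.filter fun j => ω ∈ L.Fail N j, ⟨Finset.filter_subset _ _, h⟩, fun j hj => ?_⟩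
        simp [Finset.mem_filter, hj]
      · rintro ⟨K, ⟨hKJ, hK⟩, hiff⟩
        have : J.filter (fun j => ω ∈ L.Fail N j) = K := by
          ext j
          simp only [Finset.mem_filter]
          constructor
          · rintro ⟨hj, hF⟩; exact (hiff j hj).1 hF
          · intro hjK; exact ⟨hKJ hjK, (hiff j (hKJ hjK)).2 hjK⟩
        rwa [this]
    rw [this]
    refine Finset.measurableSet_biUnion _ fun K _ => Finset.measurableSet_biInter _ fun j _ => ?_
    have h1 := LHyp.measurableSet_Fail (L := L) N j
    by_cases hjK : j ∈ K
    · have : {ω : BondConfig (Site d) | ω ∈ L.Fail N j ↔ j ∈ K} = L.Fail N j := by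
        ext ω; simp [hjK]
      rw [this]; exact h1
    · have : {ω : BondConfig (Site d) | ω ∈ L.Fail N j ↔ j ∈ K} = (L.Fail N j)ᶜ := by
        ext ω; simp [hjK]
      rw [this]; exact h1.compl
  -- both sides are integrals of the same simple function
  have hL1 : ∀ j ∈ J, μ.real (C ∩ L.Fail N j) = ∫ ω, (C ∩ L.Fail N j).indicator (1 : BondConfig (Site d) → ℝ) ω ∂μ :=
    fun j _ => (integral_indicator_one (hC.inter (LHyp.measurableSet_Fail (L := L) N j))).symm
  have hR1 : ∀ t ∈ Finset.Icc 1 J.card, μ.real (C ∩ {ω | t ≤ (J.filter fun j => ω ∈ L.Fail N j).card}) =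
      ∫ ω, (C ∩ {ω | t ≤ (J.filter fun j => ω ∈ L.Fail N j).card}).indicator (1 : BondConfig (Site d) → ℝ) ω ∂μ :=
    fun t _ => (integral_indicator_one (hC.inter (hcount t))).symm
  rw [Finset.sum_congr rfl hL1, Finset.sum_congr rfl hR1, ← integral_finsetSum, ← integral_finsetSum]
  · refine integral_congr_ae (Filter.Eventually.of_forall fun ω => ?_)
    show (∑ i ∈ J, (C ∩ L.Fail N i).indicator 1 ω) =
      ∑ i ∈ Finset.Icc 1 J.card, (C ∩ {ω | i ≤ (J.filter fun j => ω ∈ L.Fail N j).card}).indicator 1 ω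
    by_cases hω : ω ∈ C
    · have e1 : ∀ j ∈ J, (C ∩ L.Fail N j).indicator (1 : BondConfig (Site d) → ℝ) ω =
          if ω ∈ L.Fail N j then 1 else 0 := by
        intro j _
        simp only [Set.indicator_apply, Set.mem_inter_iff, hω, true_and, Pi.one_apply]
      have e2 : ∀ t ∈ Finset.Icc 1 J.card,
          (C ∩ {ω | t ≤ (J.filter fun j => ω ∈ L.Fail N j).card}).indicator (1 : BondConfig (Site d) → ℝ) ω =
            if t ≤ (J.filter fun j => ω ∈ L.Fail N j).card then 1 else 0 := by
        intro t _
        simp only [Set.indicator_apply, Set.mem_inter_iff, hω, true_and, Pi.one_apply, Set.mem_setOf_eq]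
      rw [Finset.sum_congr rfl e1, Finset.sum_congr rfl e2, Finset.sum_boole, Finset.sum_boole]
      congr 1
      set k := (J.filter fun j => ω ∈ L.Fail N j).card with hk
      have hkJ : k ≤ J.card := Finset.card_filter_le _ _
      have : (Finset.Icc 1 J.card).filter (fun t => t ≤ k) = Finset.Icc 1 k := by
        ext t; simp only [Finset.mem_filter, Finset.mem_Icc]; omega
      rw [this, Nat.card_Icc]
      omega
    · have e1 : ∀ j ∈ J, (C ∩ L.Fail N j).indicator (1 : BondConfig (Site d) → ℝ) ω = 0 := by
        intro j _
        simp only [Set.indicator_apply, Set.mem_inter_iff, hω, false_and, if_false]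
      have e2 : ∀ t ∈ Finset.Icc 1 J.card,
          (C ∩ {ω | t ≤ (J.filter fun j => ω ∈ L.Fail N j).card}).indicator (1 : BondConfig (Site d) → ℝ) ω = 0 := by
        intro t _
        simp only [Set.indicator_apply, Set.mem_inter_iff, hω, false_and, if_false]
      rw [Finset.sum_congr rfl e1, Finset.sum_congr rfl e2, Finset.sum_const_zero, Finset.sum_const_zero]
  · intro t _
    exact (integrable_const (1 : ℝ)).indicator (hC.inter (hcount t))
  · intro j _
    exact (integrable_const (1 : ℝ)).indicator (hC.inter (LHyp.measurableSet_Fail (L := L) N j))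

/-- **STEP II under `μ`** (KN p. 18): if pairs of weight `0` are a.s. closed, deletion tolerance holds on the pairs of weight `p`,
`μ(o ↔ B) > 1 - δ`, and the level range `J = [j₀, j₁]`, `j₁ ≤ R`, has at least `(1-p)^{-2dN} / δ` levels, then at some level `j ∈ J`
there are at least `N` contact vertices with probability `> 1 - 2δ`.  KN's argument verbatim: `E[X] ≥ δ|J|` against the tail bound
`μ(o ↔ B, ≥ t failure levels) ≤ μ(A_t) ≤ (1 - (1-p)^{2dN})^t` (`real_Aev_le`). [cite: KozmaNitzan2024, §4 p. 18 (Step II, eqs. (17)–(18))] -/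
theorem stepII (hnull : μ.real (LData.PosOnly W)ᶜ = 0)
    (hdel : ∀ (F : Finset (Sym2 (Site d))) (A : Set (BondConfig (Site d))), (∀ e ∈ F, W e = p) → MeasurableSet A →
      (1 - (p : ℝ)) ^ F.card * μ.real ((fun ω => ω \ ↑F) ⁻¹' A) ≤ μ.real A)
    (hp1 : (p : ℝ) < 1) {N j₀ j₁ : ℕ} (hj₁ : j₁ ≤ R) {δ : ℝ}
    (hJ : 1 / (1 - (p : ℝ)) ^ (2 * d * N) ≤ δ * ((Finset.Icc j₀ j₁).card : ℝ))
    (hreach : 1 - δ < μ.real L.reachB) :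
    ∃ j ∈ Finset.Icc j₀ j₁, 1 - 2 * δ < μ.real (L.Fail N j)ᶜ := by
  set J := Finset.Icc j₀ j₁ with hJdef
  have hJle : ∀ j ∈ J, j ≤ R := fun j hj => (Finset.mem_Icc.1 hj).2.trans hj₁
  set c : ℝ := (1 - (p : ℝ)) ^ (2 * d * N) with hc
  have hc0 : 0 < c := pow_pos (by linarith) _
  have hc1 : c ≤ 1 := pow_le_one₀ (sub_nonneg.2 p.2.2) (sub_le_self _ p.2.1)
  set r : ℝ := 1 - c with hr
  have hr0 : 0 ≤ r := by rw [hr]; linarith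
  have hr1 : r < 1 := by rw [hr]; linarith
  -- `J` is nonempty
  have hJne : J.Nonempty := by
    rw [← Finset.card_pos]
    by_contra h0
    push Not at h0
    have : (J.card : ℝ) = 0 := by exact_mod_cast Nat.le_zero.1 h0
    rw [this, mul_zero] at hJ
    have : 0 < 1 / c := by positivity
    linarith
  -- tails: `μ(o ↔ B, t ≤ #fails) ≤ r^t`
  have htail : ∀ t ∈ Finset.Icc 1 J.card,
      μ.real (L.reachB ∩ {ω | t ≤ (J.filter fun j => ω ∈ L.Fail N j).card}) ≤ r ^ t := by
    intro t ht
    have ht1 : 1 ≤ t := (Finset.mem_Icc.1 ht).1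
    have hcov : L.reachB ∩ {ω | t ≤ (J.filter fun j => ω ∈ L.Fail N j).card} ⊆
        L.Aev N J t ∪ (LData.PosOnly W)ᶜ := by
      intro ω hω
      by_cases hpos : ω ∈ LData.PosOnly W
      · exact Or.inl (hL.reachB_inter_subset_Aev hJle ht1 ⟨⟨hω.1, hpos⟩, hω.2⟩)
      · exact Or.inr hpos
    calc _ ≤ μ.real (L.Aev N J t ∪ (LData.PosOnly W)ᶜ) := measureReal_mono hcov
      _ ≤ μ.real (L.Aev N J t) + μ.real (LData.PosOnly W)ᶜ := measureReal_union_le _ _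
      _ ≤ r ^ t := by rw [hnull, add_zero]; exact real_Aev_le μ hL hdel hJle t
  -- the sum over levels is at most `1/c`
  have hsum : ∑ j ∈ J, μ.real (L.reachB ∩ L.Fail N j) ≤ 1 / c := by
    rw [sum_real_inter_Fail_eq μ (L := L) N J LHyp.measurableSet_reachB]
    calc _ ≤ ∑ t ∈ Finset.Icc 1 J.card, r ^ t := Finset.sum_le_sum htail
      _ ≤ ∑ t ∈ Finset.range (J.card + 1), r ^ t := by
          refine Finset.sum_le_sum_of_subset_of_nonneg (fun t ht => ?_) (fun t _ _ => pow_nonneg hr0 t)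
          rw [Finset.mem_range]; rw [Finset.mem_Icc] at ht; omega
      _ = (r ^ (J.card + 1) - 1) / (r - 1) := geom_sum_eq hr1.ne _
      _ ≤ 1 / c := by
          have e1 : (r ^ (J.card + 1) - 1) / (r - 1) = (1 - r ^ (J.card + 1)) / c := by
            have hc' : r - 1 = -c := by rw [hr]; ring
            rw [hc', div_neg, ← neg_div, neg_sub]
          rw [e1]
          exact div_le_div_of_nonneg_right (by linarith [pow_nonneg hr0 (J.card + 1)]) hc0.le
  -- some level has `μ(o ↔ B, Fail_j) ≤ δ`
  obtain ⟨j, hj, hjle⟩ := Finset.exists_le_of_sum_le hJne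
    (f := fun j => μ.real (L.reachB ∩ L.Fail N j)) (g := fun _ => (1 / c) / J.card) (by
      rw [Finset.sum_const, nsmul_eq_mul, mul_div_cancel₀ _ (by exact_mod_cast hJne.card_pos.ne')]
      exact hsum)
  refine ⟨j, hj, ?_⟩
  have hjδ : μ.real (L.reachB ∩ L.Fail N j) ≤ δ := by
    refine hjle.trans ?_
    rw [div_le_iff₀ (by exact_mod_cast hJne.card_pos)]
    exact hJ
  -- `μ(Fail_jᶜ) ≥ μ(o ↔ B) - μ(o ↔ B, Fail_j)`
  have hsplit : μ.real L.reachB ≤ μ.real (L.reachB ∩ L.Fail N j) + μ.real (L.Fail N j)ᶜ := by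
    rw [← measureReal_inter_add_sdiff (s := L.reachB) (LHyp.measurableSet_Fail (L := L) N j)]
    refine add_le_add le_rfl (measureReal_mono fun ω hω => hω.2)
  linarith

end StepII

section Combined

variable {L : LData d} {D : Finset (Site d)} {R : ℕ} (hL : LHyp L W p D R)
include hL

/-- **Seed manufacture, Steps II + III combined** (KN (19): "`P(𝒢) > 1 - 3δ`"): under the hypotheses of `stepII` and insertion tolerance,
if moreover `(1 - π^{seedBound d M})^k ≤ δ`, then at the level `j` found in Step II the event "at least `Ncont d M k` contact vertices AND
some selected contact vertex carries an open seed" (`Gev`) has probability `> 1 - 3δ`.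
[cite: KozmaNitzan2024, §4 p. 19 eqs. (19)–(20)] -/
theorem exists_level_real_Gev_gt [NeZero d] {π : ℝ} (hπ0 : 0 ≤ π) (hπ1 : π ≤ 1) (hnull : μ.real (LData.PosOnly W)ᶜ = 0)
    (hdel : ∀ (F : Finset (Sym2 (Site d))) (A : Set (BondConfig (Site d))), (∀ e ∈ F, W e = p) → MeasurableSet A →
      (1 - (p : ℝ)) ^ F.card * μ.real ((fun ω => ω \ ↑F) ⁻¹' A) ≤ μ.real A)
    (hins : ∀ (F : Finset (Sym2 (Site d))) (A : Set (BondConfig (Site d))), (∀ e ∈ F, W e = p) → MeasurableSet A →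
      π ^ F.card * μ.real ((fun ω => ω ∪ ↑F) ⁻¹' A) ≤ μ.real A)
    (hp1 : (p : ℝ) < 1) {M k j₀ j₁ : ℕ} (hj₁ : j₁ ≤ R) (hwide : ∀ j ∈ Finset.Icc j₀ j₁, ∀ i, L.Lo j i + 2 * M + 2 ≤ L.Hi j i)
    {δ : ℝ} (hJ : 1 / (1 - (p : ℝ)) ^ (2 * d * LData.Ncont d M k) ≤ δ * ((Finset.Icc j₀ j₁).card : ℝ))
    (hk : (1 - π ^ seedBound d M) ^ k ≤ δ) (hreach : 1 - δ < μ.real L.reachB) :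
    ∃ j ∈ Finset.Icc j₀ j₁, 1 - 3 * δ < μ.real (L.Gev j M k) := by
  obtain ⟨j, hj, hfail⟩ := stepII μ hL hnull hdel hp1 hj₁ hJ hreach
  refine ⟨j, hj, ?_⟩
  have hjR : j ≤ R := (Finset.mem_Icc.1 hj).2.trans hj₁
  have h3 := real_manyContacts_diff_Gev_le μ hL hπ0 hπ1 hins (j := j) (M := M) (k := k) hjR (hwide j hj)
  have hsplit : μ.real (L.Fail (LData.Ncont d M k) j)ᶜ ≤
      μ.real ((L.Fail (LData.Ncont d M k) j)ᶜ \ L.Gev j M k) + μ.real (L.Gev j M k) := by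
    calc μ.real (L.Fail (LData.Ncont d M k) j)ᶜ
        ≤ μ.real (((L.Fail (LData.Ncont d M k) j)ᶜ \ L.Gev j M k) ∪ L.Gev j M k) :=
          measureReal_mono (fun ω hω => by
            by_cases hG : ω ∈ L.Gev j M k
            · exact Or.inr hG
            · exact Or.inl ⟨hω, hG⟩) (measure_ne_top _ _)
      _ ≤ _ := measureReal_union_le _ _
  linarith

end Combined

end Summit.CriticalPhenomena.PercolationContinuityZ3.Theorems.FK.KNFree

end
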